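import Summits.KontsevichZagierPeriods.Zeta5Search.Barrier.ConeGammaGapTable

/-!
# ζ(5) search — BARRIER: a LINEAR scan form of the gap-table test (for long tables)

HONEST FRAMING (cell `pub-zeta5`): systematic search; no irrationality claim unless kernel-certified. MODEL objects
under Brown–Zudilin's (28)+(30) accounting ([BZ22] = arXiv:2210.03391); nothing here is a statement about `ζ(5)`;
records in print UNMOVED. Sequel of `ConeGammaGapTable` (seat P2 g13). `gapsCheck a gs` reads gap `m` and gap `m+1`
with `List.getD`, which makes the kernel build `O(M²)` intermediate terms — harmless at `M = 102` (record) or `212`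
(flag), fatal at `M = 2 750` (the ridge direction `t*`: the kernel check dies). This file gives the same test as ONE
structural pass over the list (`scanFrom` / `gapsScan`, `O(M)` terms; chunkable through `scanFrom_append` /
`gapsScan_cons_chunk`, one kernel declaration per chunk — the kernel's memory guard stops one pass near 10³ gaps) and proves
**`gapsCheck_of_gapsScan`**: a passed scan (plus the box test and `b₀ = 0`) IS a passed `gapsCheck`, so every soundness
theorem of `ConeGammaGapTable` / `ConeGammaPhiDigammaCert` / `ConeGammaGapBlocks` applies unchanged.
-/

namespace Summit.KontsevichZagierPeriods.Zeta5Search.Barrier.ConeGamma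

/-- Scan: the current gap `g` against the head of the rest (its right endpoint), recursively; the last gap against the
terminal endpoint `nN/nD`. -/
def scanFrom (a : Fin 8 → ℤ) : GapRec → List GapRec → ℕ → ℕ → Bool
  | g, [], nN, nD => gapCheck a g nN nD
  | g, g' :: rest, nN, nD => gapCheck a g g'.loN g'.loD && scanFrom a g' rest nN nD

/-- The scan of a whole table with terminal endpoint `nN/nD` (`1/1` for a full period). -/
def gapsScan (a : Fin 8 → ℤ) (gs : List GapRec) (nN nD : ℕ) : Bool :=
  match gs with
  | [] => true
  | g :: rest => scanFrom a g rest nN nD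

/-- **Chunking**: a scan over a concatenation splits at the seam (the first chunk is scanned against the head of the
second). -/
theorem scanFrom_append (a : Fin 8 → ℤ) (nN nD : ℕ) :
    ∀ (xs : List GapRec) (g g'' : GapRec) (ys : List GapRec),
      scanFrom a g (xs ++ g'' :: ys) nN nD = (scanFrom a g xs g''.loN g''.loD && scanFrom a g'' ys nN nD) := by
  intro xs
  induction xs with
  | nil => intro g g'' ys; simp [scanFrom]
  | cons x xs ih => intro g g'' ys; simp [scanFrom, ih, Bool.and_assoc]

/-- What a passed scan says, gap by gap (terminal endpoint = the default record's `1/1`). -/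
theorem scanFrom_spec (a : Fin 8 → ℤ) :
    ∀ (rest : List GapRec) (g : GapRec), scanFrom a g rest 1 1 = true →
      ∀ m, m ≤ rest.length →
        gapCheck a ((g :: rest).getD m GapRec.dflt) ((g :: rest).getD (m + 1) GapRec.dflt).loN
          ((g :: rest).getD (m + 1) GapRec.dflt).loD = true := by
  intro rest
  induction rest with
  | nil =>
    intro g h m hm
    have hm0 : m = 0 := by simpa using hm
    subst hm0
    simpa [scanFrom, GapRec.dflt] using h
  | cons g' rest ih =>
    intro g h m hm
    simp only [scanFrom, Bool.and_eq_true] at h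
    obtain ⟨h1, h2⟩ := h
    rcases m with _ | k
    · simpa using h1
    · have hk : k ≤ rest.length := by simpa using hm
      simpa using ih g' h2 k hk

/-- **A passed linear scan is a passed `gapsCheck`.** -/
theorem gapsCheck_of_gapsScan {a : Fin 8 → ℤ} {gs : List GapRec} (hbox : boxCheck a = true)
    (h0 : (gs.getD 0 GapRec.dflt).loN = 0) (h : gapsScan a gs 1 1 = true) : gapsCheck a gs = true := by
  unfold gapsCheck
  simp only [Bool.and_eq_true, decide_eq_true_eq, List.all_eq_true, List.mem_range]
  refine ⟨⟨hbox, h0⟩, fun m hm => ?_⟩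
  cases gs with
  | nil => simp at hm
  | cons g rest =>
    unfold gapsScan at h
    exact scanFrom_spec a rest g h m (by simpa [Nat.lt_succ_iff] using hm)

/-- **Chunk step**: a table written as `h :: (t ++ h' :: rest)` passes the scan iff the first chunk `h :: t` passes against
the head `h'` of the remainder and the remainder passes — so a long table is checked chunk by chunk, one kernel
declaration per chunk (the kernel's memory guard stops a single pass at ≈ 10³ gaps). -/
theorem gapsScan_cons_chunk {a : Fin 8 → ℤ} {h h' : GapRec} {t rest : List GapRec} {nN nD : ℕ}
    (h1 : scanFrom a h t h'.loN h'.loD = true) (h2 : gapsScan a (h' :: rest) nN nD = true) :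
    gapsScan a (h :: (t ++ h' :: rest)) nN nD = true := by
  unfold gapsScan at h2 ⊢
  simp only at h2 ⊢
  rw [scanFrom_append, h1, h2, Bool.and_self]

end Summit.KontsevichZagierPeriods.Zeta5Search.Barrier.ConeGamma
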